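import Literature.NumberTheory.Automorphic.CDTTheorem722ThreeFactsProofs
import Literature.NumberTheory.EllipticCurves.EisensteinNewformLevelRaising
import Literature.NumberTheory.EllipticCurves.NewformGaloisRepEulerFactors
import Literature.NumberTheory.EllipticCurves.CuspFormLFunctionLevelConductorProofs
import Literature.NumberTheory.EllipticCurves.NewformGaloisRepThm61OfHeckeAlgebraRepProofs
import Literature.NumberTheory.EllipticCurves.NewformGaloisRepPadicAlgClProofs
import Literature.NumberTheory.GaloisRepresentations.FramedRepBaseChange
import HarnessLib

/-!
# Stub ideation `stub_threeImpTwo` — ideator k = 1, generation 6 (FAMILY 1: recognise & import)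

Companion of `STUB-IDEAS-stub_threeImpTwo-1.md` (gen 6).  Gens 1–5 fixed S9's decomposition
`S9 ⇐ R(3) ∧ R(5) ∧ C_E ∧ (level = conductor)` with `R(p) = RealisationAt p` (gen-5 k1, verbatim
below) fed only by the XL apex `Hida2000_thm326_exists_galoisRep = thm61_exists_adicGaloisRep`
(Deligne at EVERY weight `k ≥ 2`).

NEW in gen 6 (the import, tree match + literature match): the `R`-leaf is typed one level DOWN, in
the PRODUCER currency the tree already has and no crux file has used —
`ModularForms.DeligneHeckeRep p N 2` (`NewformGaloisRepThm61OfHeckeAlgebraRepProofs`): a framed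
`ρ_𝕋 : Γ_ℚ → GL₂(ℚ_p ⊗_ℤ 𝕋_ℤ)` over the `p`-adic Hecke algebra of `S₂(Γ₁(N))`, unramified at
`q ∤ N p` with `charpoly(Frob_q) = X² - (1 ⊗ T_q) X + q (1 ⊗ ⟨q⟩)` — in weight `2` LITERALLY
Conrad's Lemma 5.11 + Thm. 5.12 (`ℚ_p ⊗ T_p(J₁(N))` free of rank `2` over `ℚ_p ⊗ 𝕋₁(N)` with the
Eichler–Shimura congruence relation), i.e. abelian-variety mathematics (Tate module of a Jacobian,
Néron–Ogg–Shafarevich, Eichler–Shimura), not Deligne's étale cohomology of Kuga–Sato varieties.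

* `JacobianLeafAt p := ∀ N ≥ 1, Nonempty (DeligneHeckeRep p N 2)` — the weight-two leaf `J(p)`.
* H1 `isGaloisRepOfNewform1_of_deligneHeckeRep` (XS, PROVED): per level / weight / prime, Conrad's
  Cor. 5.15 — `ρ_𝕋 ⊗_{lift(ι ∘ θ_g)} E` is attached to the newform `g` through ANY `ι : K_g → E` into
  ANY topological `ℚ_p`-algebra field `E` (the tree's `thm21_forall_of_deligneHeckeRep` body, with
  its `∀ N k ℓ` hypothesis localised and its finite-dimensionality hypothesis on `E` dropped —
  `PadicHeckeAlgebra.continuous_lift` needs only `ContinuousAdd`/`ContinuousSMul`).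
* H1⁺ (XS, PROVED): `E := ℚ̄_p` directly, coefficient map `ι⁻¹ ∘ (K_g ⊆ ℂ)` ON THE NOSE.
* H2 `exists_padicAlgClRep_of_deligneHeckeRep` (S, PROVED): `+ irreducible over ℚ̄_p` — H1 at the
  completion `K_{g,v}` cut out by `ι⁻¹ ∘ (K_g ⊆ ℂ)` (tree: `exists_heightOneSpectrum_of_ringHom_padicAlgCl`,
  `exists_continuous_ringHom_adicCompletion_padicAlgCl`), Ribet (2.3) PROVED in the tree
  (`Ribet1977.isAbsolutelyIrreducible_of_thm23 thm23_isIrreducible_holds`), base change along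
  `K_{g,v} → ℚ̄_p` — verbatim the second half of the tree's `Hida2000_thm326_exists_galoisRep_of_thm61`.
* H3 (XS, PROVED): `J(p) → RealisationAt p`;  H4 (XS, PROVED): the all-weights hypothesis of the tree
  gives `RealisationAt p` at every `p` through `Hida2000_thm326_exists_galoisRep_of_deligneHeckeRep`.
* L5/H5 (M/S, `sorry` — the stub prover's work, unchanged from gen 5; proved blocks in gen 3's
  companion), L6/L7 (PROVED from them, verbatim gen 5), and the gen-6 closer
  `sigS9_of_jacobianLeaf_three_five : C_E → J(3) → J(5) → (level = conductor) → S9` (PROVED from L7).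

`sorry` only inside L5 and H5.
-/

noncomputable section

open scoped NumberField Polynomial MatrixGroups ModularForm
open NumberField IsDedekindDomain IsDedekindDomain.HeightOneSpectrum Field Polynomial
open CongruenceSubgroup Rat.HeightOneSpectrum
open Literature.NumberTheory.EllipticCurves
open Literature.NumberTheory.EllipticCurves.ModularForms
open Literature.NumberTheory.EllipticCurves.ModularForms.DeligneSerre1974
open Literature.NumberTheory.Automorphic
open Literature.NumberTheory.Automorphic.BCDT
open Literature.NumberTheory.GaloisRepresentations
open WeierstrassCurve

namespace Summit.ABC.ABC.Cruxes.FreyModularity.Sketch.StubIdeasThreeImpTwo1G6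

/-- The registered stub's type, character for character (`Lines/Sketch.lean`, `stub_threeImpTwo`). -/
def SigS9 : Prop :=
  ∀ (W : WeierstrassCurve ℚ) [W.IsElliptic] [NeZero (W.conductorNorm ℤ)] (ℓ : ℕ) [Fact ℓ.Prime],
    W.IsModularGaloisRepTate ℓ → BCDT.IsModular W

example : SigS9 = (∀ (W : WeierstrassCurve ℚ) [W.IsElliptic] [NeZero (W.conductorNorm ℤ)] (ℓ : ℕ)
    [Fact ℓ.Prime], W.IsModularGaloisRepTate ℓ → BCDT.IsModular W) := rfl

/-- **`R(p)`** (verbatim gen-5 k1): Deligne realisation of RATIONAL weight-two `Γ₀`-newforms at the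
FIXED prime `p`, in Carayol's currency. -/
def RealisationAt (p : ℕ) [Fact p.Prime] : Prop :=
  ∀ {N : ℕ} [NeZero N] (f₀ : CuspForm (Gamma0 N) 2), IsNewform0 f₀ →
    (∀ n : ℕ, ∃ z : ℤ, cuspCoeff f₀ n = z) → ∀ ι : PadicAlgCl p ≃+* ℂ,
      ∃ ρ : FramedGaloisRep ℚ (PadicAlgCl p) 2,
        IsGaloisRepOfNewform1 (liftToGamma1 N 2 f₀)
          ((ι.symm : ℂ →+* PadicAlgCl p).comp (algebraMap (coeffCharField (liftToGamma1 N 2 f₀)) ℂ))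
          {q | q ∣ N * p} ρ ∧
        ρ.toGaloisRep.IsIrreducible

/-! ## §Gen6 — the weight-two Jacobian leaf `J(p)` and its proved road to `R(p)` -/

/-- **`J(p)` — the weight-two Jacobian leaf at the prime `p`** (NEW, gen 6): for every level
`N ≥ 1`, Deligne's (here: Shimura's) representation over the `p`-adic Hecke algebra of
`S₂(Γ₁(N))` exists — `ℚ_p ⊗ T_p(J₁(N))` framed over `ℚ_p ⊗ 𝕋₁(N)` (Conrad, Lemma 5.11, Thm. 5.12,
Cor. 5.9; Diamond–Shurman Thm. 9.5.4 / Lemma 9.5.3).  A hypothesis SHAPE over the tree's structure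
`DeligneHeckeRep`; not a named fact. -/
def JacobianLeafAt (p : ℕ) [Fact p.Prime] : Prop :=
  ∀ (N : ℕ) [NeZero N], Nonempty (DeligneHeckeRep p N 2)

/-- **H1 (XS, PROVED) — Conrad Cor. 5.15 per level, any coefficient field.**  For ONE
`D : DeligneHeckeRep ℓ M k`, a newform `g ∈ S_k(Γ₁(M))` and ANY ring map `ι : K_g → E` into a field
which is a topological `ℚ_ℓ`-algebra (`ContinuousAdd`, `ContinuousSMul ℚ_ℓ`; NO finite-dimensionality),
the base change of `D.ρ` along `lift (ι ∘ θ_g) : ℚ_ℓ ⊗ 𝕋_ℤ → E` is attached to `g` through `ι` away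
from `M ℓ`.  Body = the tree's `thm21_forall_of_deligneHeckeRep` minus its first line. -/
theorem isGaloisRepOfNewform1_of_deligneHeckeRep {ℓ : ℕ} [Fact ℓ.Prime] {M : ℕ} [NeZero M]
    {k : ℤ} (D : DeligneHeckeRep ℓ M k) {g : CuspForm (Gamma1 M) k} (hg : IsNewform1 g)
    (E : Type) [Field E] [Algebra ℚ_[ℓ] E] [TopologicalSpace E] [ContinuousAdd E]
    [ContinuousSMul ℚ_[ℓ] E] (ι : coeffCharField g →+* E) :
    ∃ ρ : FramedGaloisRep ℚ E 2, IsGaloisRepOfNewform1 g ι {p | p ∣ M * ℓ} ρ := by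
  have hφc : Continuous
      (PadicHeckeAlgebra.lift ℓ (ι.comp hg.eigencharacterK) : PadicHeckeAlgebra ℓ M k →+* E) :=
    PadicHeckeAlgebra.continuous_lift ℓ (ι.comp hg.eigencharacterK)
  refine ⟨FramedRep.baseChange _ hφc D.ρ, fun v hv ↦ ⟨?_, ?_⟩⟩
  · -- unramified at `q ∤ M ℓ`: the kernel only grows under base change
    intro 𝔓 h𝔓 σ hσ
    rw [FramedRep.baseChange_apply, D.isUnramifiedAt v hv 𝔓 h𝔓 σ hσ, map_one]
  · -- the Frobenius polynomial maps to the Hecke polynomial of `g`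
    have hq : ¬ ((primesEquiv v : Nat.Primes) : ℕ) ∣ M := fun h ↦ hv (dvd_mul_of_dvd_left h ℓ)
    have h := FramedGaloisRep.hasFrobCharpolyAt_baseChange _ hφc (D.hasFrobCharpolyAt v hv)
    rwa [hg.map_frobPoly_eigencharacter ℓ ι (primesEquiv v) hq] at h

/-- **H1⁺ (XS, PROVED) — straight to `ℚ̄_p`.**  With `E := ℚ̄_p` and
`ι := ι₀⁻¹ ∘ (K_g ⊆ ℂ)` for a field isomorphism `ι₀ : ℚ̄_p ≃ ℂ`, H1 gives the ATTACHMENT clause of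
`R(p)` / Hida 3.26 (1) for EVERY newform (rational or not) with the coefficient map on the nose —
no place `v`, no completion. -/
theorem exists_isGaloisRepOfNewform1_padicAlgCl_of_deligneHeckeRep {p : ℕ} [Fact p.Prime]
    {M : ℕ} [NeZero M] {k : ℤ} (D : DeligneHeckeRep p M k) {g : CuspForm (Gamma1 M) k}
    (hg : IsNewform1 g) (ι₀ : PadicAlgCl p ≃+* ℂ) :
    ∃ ρ : FramedGaloisRep ℚ (PadicAlgCl p) 2,
      IsGaloisRepOfNewform1 g
        ((ι₀.symm : ℂ →+* PadicAlgCl p).comp (algebraMap (coeffCharField g) ℂ)) {q | q ∣ M * p} ρ :=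
  isGaloisRepOfNewform1_of_deligneHeckeRep D hg (PadicAlgCl p) _

/-- **H2 (S, PROVED) — `J`-currency to Carayol's currency, with irreducibility.**  For ONE
`D : DeligneHeckeRep p N k`, a newform `g` of weight `k ≥ 2` and `ι₀ : ℚ̄_p ≃ ℂ`: an IRREDUCIBLE
`ρ : Γ_ℚ → GL₂(ℚ̄_p)` attached to `g` through `ι₀⁻¹ ∘ (K_g ⊆ ℂ)` away from `N p`.  Route: the
embedding `j = ι₀⁻¹ ∘ (K_g ⊆ ℂ)` cuts out a place `v ∣ p` of the number field `K_g` and extends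
continuously to `φ : K_{g,v} → ℚ̄_p`; H1 at `E := K_{g,v}` (finite over `ℚ_p`, module topology);
Ribet (2.3) + oddness (PROVED in the tree) make it absolutely irreducible; base-change along `φ`.
Verbatim the tree's `Hida2000_thm326_exists_galoisRep_of_thm61` with Thm. 6.1 replaced by H1. -/
theorem exists_padicAlgClRep_of_deligneHeckeRep {p : ℕ} [Fact p.Prime] {N : ℕ} [NeZero N]
    {k : ℤ} (D : DeligneHeckeRep p N k) {g : CuspForm (Gamma1 N) k} (hk : 2 ≤ k)
    (hg : IsNewform1 g) (ι₀ : PadicAlgCl p ≃+* ℂ) :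
    ∃ ρ : FramedGaloisRep ℚ (PadicAlgCl p) 2,
      IsGaloisRepOfNewform1 g
        ((ι₀.symm : ℂ →+* PadicAlgCl p).comp (algebraMap (coeffCharField g) ℂ)) {q | q ∣ N * p} ρ ∧
      ρ.toGaloisRep.IsIrreducible := by
  classical
  -- `K_g` is a number field (Deligne–Serre (2.7.2)–(2.7.3), proved in the tree)
  haveI : FiniteDimensional ℚ (coeffField g) :=
    (IsNewform1.finiteDimensional_coeffField_of_span_integralLattice1
      (DeligneSerre1974_span_integralLattice1_holds N k)) hg
  haveI : FiniteDimensional ℚ (coeffCharField g) :=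
    DeligneSerre1974.finiteDimensional_coeffCharField g
  haveI : NumberField (coeffCharField g) := NumberField.mk
  -- the embedding `j = ι₀⁻¹ ∘ (K_g ⊆ ℂ)`, its place `v ∣ p`, and `φ : K_v → ℚ̄_p`
  set j : coeffCharField g →+* PadicAlgCl p :=
    (ι₀.symm : ℂ →+* PadicAlgCl p).comp (algebraMap (coeffCharField g) ℂ) with hjdef
  obtain ⟨v, hpv, hjv⟩ := exists_heightOneSpectrum_of_ringHom_padicAlgCl j
  obtain ⟨φ, hφc, hφj⟩ := exists_continuous_ringHom_adicCompletion_padicAlgCl j v hpv hjv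
  have hφcomp : φ.comp (algebraMap (coeffCharField g) (v.adicCompletion (coeffCharField g))) = j :=
    RingHom.ext hφj
  -- `K_v` is a finite extension of `ℚ_p` with its module topology
  letI := Literature.NumberTheory.GaloisRepresentations.LocalField.adicCompletionPadicAlgebra v p hpv
  haveI := finiteDimensional_padic_adicCompletion v p hpv
  haveI := isModuleTopology_padic_adicCompletion v p hpv
  haveI : ContinuousSMul ℚ_[p] (v.adicCompletion (coeffCharField g)) :=
    continuousSMul_padic_adicCompletion v p hpv
  -- H1 at `E := K_v`, `ι := (K_g → K_v)`
  obtain ⟨ρ, hρg⟩ := isGaloisRepOfNewform1_of_deligneHeckeRep D hg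
    (v.adicCompletion (coeffCharField g))
    (algebraMap (coeffCharField g) (v.adicCompletion (coeffCharField g)))
  -- Ribet's Thm. (2.3) (PROVED in the tree) with oddness: absolutely irreducible
  have habs : FramedRep.IsAbsolutelyIrreducible ρ :=
    Ribet1977.isAbsolutelyIrreducible_of_thm23 Ribet1977.thm23_isIrreducible_holds hg (by omega) hρg
  -- base change along `φ`
  refine ⟨FramedRep.baseChange φ hφc ρ, ?_, ?_⟩
  · intro w hw
    obtain ⟨hur, hchar⟩ := hρg w hw
    refine ⟨(FramedGaloisRep.isUnramifiedAt_baseChange_iff φ hφc φ.injective w ρ).mpr hur, ?_⟩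
    have h := FramedGaloisRep.hasFrobCharpolyAt_baseChange φ hφc hchar
    rwa [Polynomial.map_map, hφcomp] at h
  · exact habs (PadicAlgCl p) φ

/-- **H3 (XS, PROVED): `J(p) → R(p)`** — H2 at `k = 2`, `g := liftToGamma1 N 2 f₀`
(`isNewform1_liftToGamma1_iff_holds`); rationality of `f₀` is not even used. -/
theorem realisationAt_of_jacobianLeafAt {p : ℕ} [Fact p.Prime] (H : JacobianLeafAt p) :
    RealisationAt p := by
  intro N _ f₀ hf₀ _ ι
  obtain ⟨D⟩ := H N
  exact exists_padicAlgClRep_of_deligneHeckeRep D le_rfl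
    ((isNewform1_liftToGamma1_iff_holds (N := N) (k := 2) f₀).mpr hf₀) ι

/-- Gen-5 L3 (XS, PROVED, kept for H4): Hida 3.26 (1) ⇒ `R(p)`. -/
theorem realisationAt_of_hida (hD : Hida2000_thm326_exists_galoisRep) (p : ℕ) [Fact p.Prime] :
    RealisationAt p := by
  intro N _ f₀ hf₀ _ ι
  exact hD (liftToGamma1 N 2 f₀) le_rfl
    ((isNewform1_liftToGamma1_iff_holds (N := N) (k := 2) f₀).mpr hf₀) p ι

/-- **H4 (XS, PROVED; tree match)**: the tree's ALL-WEIGHTS hypothesis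
`∀ N k ≥ 2 ℓ, Nonempty (DeligneHeckeRep ℓ N k)` already gives `R(p)` at every `p` through the PROVED
`Hida2000_thm326_exists_galoisRep_of_deligneHeckeRep` — zero new glue, but a leaf as strong as
Deligne's theorem; H3 is the weight-two cut. -/
theorem realisationAt_of_deligneHeckeRep_allWeights
    (H : ∀ (N : ℕ) [NeZero N] (k : ℤ), 2 ≤ k → ∀ (ℓ : ℕ) [Fact ℓ.Prime],
      Nonempty (DeligneHeckeRep ℓ N k))
    (p : ℕ) [Fact p.Prime] : RealisationAt p :=
  realisationAt_of_hida (Hida2000_thm326_exists_galoisRep_of_deligneHeckeRep H) p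

/-! ## Gen-5 core, verbatim (L5/H5 are the stub prover's M/S items; L6/L7 PROVED from them) -/

/-- **L5 (M; PROVED in gen 3 as the `q ≠ p'` branch of `key`).**  One realisation `ρ_g` of the
rational newform `f₀` at `p'`, plus `a_q(f₀) = a_q(W)` off a finite set and Carayol–Euler, gives
`a_q(f₀) = a_q(W)` and `q ∣ N ↔ q ∣ N_W` at EVERY prime `q ≠ p'` (Chebotarev + Brauer–Nesbitt,
`ρ_g ≅ V_{p'}W ⊗ ℚ̄`; Carayol's Euler factor at `q` = that of `V_{p'}W`). -/
theorem cuspCoeff_eq_and_dvd_iff_of_realisation (hCE : Carayol1986_eulerFactor)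
    (W : WeierstrassCurve ℚ) [W.IsElliptic] {N : ℕ} [NeZero N] (f₀ : CuspForm (Gamma0 N) 2)
    (hf₀ : IsNewform0 f₀) {T₀ : ℕ} (hT₀ : T₀ ≠ 0)
    (hfp : ∀ p : ℕ, p.Prime → ¬ p ∣ T₀ → cuspCoeff f₀ p = (W.LFunction p : ℂ))
    (p' : ℕ) [Fact p'.Prime] (ι : PadicAlgCl p' ≃+* ℂ) (ρg : FramedGaloisRep ℚ (PadicAlgCl p') 2)
    (hρg : IsGaloisRepOfNewform1 (liftToGamma1 N 2 f₀)
      ((ι.symm : ℂ →+* PadicAlgCl p').comp (algebraMap (coeffCharField (liftToGamma1 N 2 f₀)) ℂ))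
      {q | q ∣ N * p'} ρg)
    (hirr : ρg.toGaloisRep.IsIrreducible) (q : ℕ) (hq : q.Prime) (hqp : q ≠ p') :
    cuspCoeff f₀ q = (W.LFunction q : ℂ) ∧ (q ∣ N ↔ q ∣ W.conductorNorm ℤ) := by
  sorry

/-- **H5 (S; PROVED in gen 3 as `H5_isNewformOf_of_forall_prime_cuspCoeff_eq_of_dvd_iff`).** -/
theorem isNewformOf_of_forall_prime (W : WeierstrassCurve ℚ) [W.IsElliptic] {N : ℕ} [NeZero N]
    {f₀ : CuspForm (Gamma0 N) 2} (hf₀ : IsNewform0 f₀)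
    (hdvd : ∀ q : ℕ, q.Prime → (q ∣ N ↔ q ∣ W.conductorNorm ℤ))
    (hfp : ∀ q : ℕ, q.Prime → cuspCoeff f₀ q = (W.LFunction q : ℂ)) : IsNewformOf W f₀ := by
  sorry

/-- **L6 (PROVED from L5 + H5)**: two realisations at distinct primes + Carayol–Euler ⇒ a newform
of `W` at some level with the prime support of `N_W`. -/
theorem exists_isNewformOf_of_two_realisations (hCE : Carayol1986_eulerFactor)
    {p₁ p₂ : ℕ} [Fact p₁.Prime] [Fact p₂.Prime] (hne : p₁ ≠ p₂)
    (h₁ : RealisationAt p₁) (h₂ : RealisationAt p₂)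
    (W : WeierstrassCurve ℚ) [W.IsElliptic] [NeZero (W.conductorNorm ℤ)] (ℓ : ℕ) [Fact ℓ.Prime]
    (h : W.IsModularGaloisRepTate ℓ) :
    ∃ (N : ℕ) (_ : NeZero N) (f₀ : CuspForm (Gamma0 N) 2), IsNewformOf W f₀ := by
  classical
  have hℓ : ℓ.Prime := Fact.out
  obtain ⟨N, hN, f₀, hf₀, hrat, hfp⟩ := exists_rational_isNewform0_of_isModularGaloisRepTate' W ℓ h
  have hT₀ : N * (ℓ * W.conductorNorm ℤ) ≠ 0 :=
    mul_ne_zero (NeZero.ne N) (mul_ne_zero hℓ.ne_zero (NeZero.ne _))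
  obtain ⟨ι₁⟩ := PadicAlgCl.nonempty_ringEquiv_complex p₁
  obtain ⟨ι₂⟩ := PadicAlgCl.nonempty_ringEquiv_complex p₂
  obtain ⟨ρ₁, hρ₁, hirr₁⟩ := h₁ f₀ hf₀ hrat ι₁
  obtain ⟨ρ₂, hρ₂, hirr₂⟩ := h₂ f₀ hf₀ hrat ι₂
  have key : ∀ q : ℕ, q.Prime →
      cuspCoeff f₀ q = (W.LFunction q : ℂ) ∧ (q ∣ N ↔ q ∣ W.conductorNorm ℤ) := by
    intro q hq
    by_cases hq₁ : q = p₁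
    · exact cuspCoeff_eq_and_dvd_iff_of_realisation hCE W f₀ hf₀ hT₀ hfp p₂ ι₂ ρ₂ hρ₂ hirr₂ q hq
        (hq₁ ▸ hne)
    · exact cuspCoeff_eq_and_dvd_iff_of_realisation hCE W f₀ hf₀ hT₀ hfp p₁ ι₁ ρ₁ hρ₁ hirr₁ q hq hq₁
  exact ⟨N, hN, f₀, isNewformOf_of_forall_prime W hf₀ (fun q hq ↦ (key q hq).2)
    fun q hq ↦ (key q hq).1⟩

/-- **L7 (PROVED from L6)**: the verbatim stub from `R(p₁)`, `R(p₂)` (`p₁ ≠ p₂`), Carayol–Euler and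
the catalogued level fact `IsNewformOf.level_eq_conductorNorm`. -/
theorem sigS9_of_two_realisations (hCE : Carayol1986_eulerFactor)
    {p₁ p₂ : ℕ} [Fact p₁.Prime] [Fact p₂.Prime] (hne : p₁ ≠ p₂)
    (h₁ : RealisationAt p₁) (h₂ : RealisationAt p₂)
    (hC : ∀ (N : ℕ) [NeZero N], IsNewformOf.level_eq_conductorNorm (N := N)) : SigS9 := by
  intro W _ _ ℓ _ h
  obtain ⟨N, hN, f₀, hWf⟩ := exists_isNewformOf_of_two_realisations hCE hne h₁ h₂ W ℓ h
  have hNW : N = W.conductorNorm ℤ := hC N hWf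
  subst hNW
  exact ⟨f₀, hWf⟩

/-! ## Gen-6 closers -/

/-- **S9 from the two weight-two Jacobian leaves `J(3)`, `J(5)`, Carayol–Euler and the level fact**
(PROVED from L7 via H3).  The primes `3, 5` are those at which the co-stubs `stub_liftThree` /
`stub_liftFive` consume `ρ_𝕋` localised at a maximal ideal — the SAME object. -/
theorem sigS9_of_jacobianLeaf_three_five (hCE : Carayol1986_eulerFactor)
    (h3 : @JacobianLeafAt 3 ⟨Nat.prime_three⟩) (h5 : @JacobianLeafAt 5 ⟨by norm_num⟩)
    (hC : ∀ (N : ℕ) [NeZero N], IsNewformOf.level_eq_conductorNorm (N := N)) : SigS9 :=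
  haveI : Fact (Nat.Prime 3) := ⟨Nat.prime_three⟩
  haveI : Fact (Nat.Prime 5) := ⟨by norm_num⟩
  sigS9_of_two_realisations hCE (p₁ := 3) (p₂ := 5) (by decide)
    (realisationAt_of_jacobianLeafAt h3) (realisationAt_of_jacobianLeafAt h5) hC

/-- The same with the tree's all-weights hypothesis (H4), for comparison. PROVED. -/
theorem sigS9_of_deligneHeckeRep_allWeights (hCE : Carayol1986_eulerFactor)
    (H : ∀ (N : ℕ) [NeZero N] (k : ℤ), 2 ≤ k → ∀ (ℓ : ℕ) [Fact ℓ.Prime],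
      Nonempty (DeligneHeckeRep ℓ N k))
    (hC : ∀ (N : ℕ) [NeZero N], IsNewformOf.level_eq_conductorNorm (N := N)) : SigS9 :=
  haveI : Fact (Nat.Prime 3) := ⟨Nat.prime_three⟩
  haveI : Fact (Nat.Prime 5) := ⟨by norm_num⟩
  sigS9_of_two_realisations hCE (p₁ := 3) (p₂ := 5) (by decide)
    (realisationAt_of_deligneHeckeRep_allWeights H 3) (realisationAt_of_deligneHeckeRep_allWeights H 5) hC

/-- **Per curve, semistable away from the level fact** (`N_W` squarefree; tree's PROVED
`IsNewformOf.level_eq_conductorNorm_of_squarefree`): `J(3)`, `J(5)`, Carayol–Euler only. PROVED. -/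
theorem isModular_of_jacobianLeaf_of_squarefree (hCE : Carayol1986_eulerFactor)
    (h3 : @JacobianLeafAt 3 ⟨Nat.prime_three⟩) (h5 : @JacobianLeafAt 5 ⟨by norm_num⟩)
    (W : WeierstrassCurve ℚ) [W.IsElliptic] [NeZero (W.conductorNorm ℤ)]
    (hsq : Squarefree (W.conductorNorm ℤ)) (ℓ : ℕ) [Fact ℓ.Prime]
    (h : W.IsModularGaloisRepTate ℓ) : BCDT.IsModular W := by
  haveI : Fact (Nat.Prime 3) := ⟨Nat.prime_three⟩
  haveI : Fact (Nat.Prime 5) := ⟨by norm_num⟩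
  obtain ⟨N, hN, f₀, hWf⟩ := exists_isNewformOf_of_two_realisations hCE (p₁ := 3) (p₂ := 5)
    (by decide) (realisationAt_of_jacobianLeafAt h3) (realisationAt_of_jacobianLeafAt h5) W ℓ h
  have hNW : N = W.conductorNorm ℤ := hWf.level_eq_conductorNorm_of_squarefree hsq
  subst hNW
  exact ⟨f₀, hWf⟩

end Summit.ABC.ABC.Cruxes.FreyModularity.Sketch.StubIdeasThreeImpTwo1G6
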